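import Mathlib.Analysis.SpecialFunctions.Trigonometric.Sinc
import Mathlib.Analysis.SpecialFunctions.Integrals.Basic
import Mathlib.Analysis.Calculus.ParametricIntervalIntegral
import Mathlib.Analysis.Distribution.TemperateGrowth
import Mathlib.Analysis.Calculus.IteratedDeriv.Lemmas
import HarnessLib

/-!
# `sinc` is smooth with all derivatives bounded by `1` (hence of temperate growth)

Cohn–Kumar–Miller–Radchenko–Viazovska, arXiv:1902.05438, §5.1 (5.3): the explicit piece
`F_{2,high}(τ,r)` is entire in `r` "since the possible singularities at `r² = −2k` are compensated for by
the vanishing of `sin²(πr²/2)`": indeed `sin²(πu/2)/u = (π/2)·sinc(πu/2)·sin(πu/2)` and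
`sin²(πu/2)/u² = (π/2)²sinc²(πu/2)` with `u = r² + 2k`. To use this one needs the smoothness of
`sinc` together with polynomial (here: uniform) bounds on all its derivatives.

PROVED here from the integral representation `sinc x = ∫₀¹ cos(tx) dt`:
`∂ⁿ/∂xⁿ cos(tx) = tⁿ cos(tx + nπ/2)` (`cosD`), differentiation under the integral
(`hasDerivAt_sincI`), `iteratedDeriv n sinc = ∫₀¹ tⁿcos(tx + nπ/2) dt`, `ContDiff ℝ ∞ sinc`,
`|sinc⁽ⁿ⁾(x)| ≤ 1`, and `Function.HasTemperateGrowth Real.sinc`.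

## References

* H. Cohn, A. Kumar, S. D. Miller, D. Radchenko, M. Viazovska, Ann. of Math. 196 (2022),
  arXiv:1902.05438, §5.1 (5.3). [CohnEtAl2019]
-/

noncomputable section

open scoped Topology ContDiff
open Filter MeasureTheory Set Real intervalIntegral

namespace Literature.Analysis.Fourier

/-! ## The kernels `tⁿ cos(tx + nπ/2)` -/

/-- `∂ⁿ/∂xⁿ cos(tx) = tⁿ cos(tx + nπ/2)`. [folklore] -/
def cosD (n : ℕ) (t x : ℝ) : ℝ := t ^ n * Real.cos (t * x + n * (π / 2))

/-- `cosD_zero` (auxiliary). [folklore] -/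
theorem cosD_zero (t x : ℝ) : cosD 0 t x = Real.cos (t * x) := by simp [cosD]

/-- `hasDerivAt_cosD` (auxiliary). [folklore] -/
theorem hasDerivAt_cosD (n : ℕ) (t x : ℝ) : HasDerivAt (fun y => cosD n t y) (cosD (n + 1) t x) x := by
  have h1 : HasDerivAt (fun y : ℝ => t * y + n * (π / 2)) t x := by
    simpa using ((hasDerivAt_id x).const_mul t).add_const ((n : ℝ) * (π / 2))
  have h2 := (Real.hasDerivAt_cos (t * x + n * (π / 2))).comp x h1
  have h3 := h2.const_mul (t ^ n)
  show HasDerivAt (fun y => t ^ n * Real.cos (t * y + n * (π / 2))) (cosD (n + 1) t x) x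
  refine h3.congr_deriv ?_
  simp only [cosD]
  push_cast
  rw [show t * x + (n + 1) * (π / 2) = t * x + n * (π / 2) + π / 2 by ring, Real.cos_add_pi_div_two]
  ring

/-- `abs_cosD_le` (auxiliary): `|tⁿcos(tx + nπ/2)| ≤ 1` for `t ∈ [0,1]`. [folklore] -/
theorem abs_cosD_le (n : ℕ) {t : ℝ} (ht0 : 0 ≤ t) (ht1 : t ≤ 1) (x : ℝ) : |cosD n t x| ≤ 1 := by
  rw [cosD, abs_mul, abs_pow, abs_of_nonneg ht0]
  exact mul_le_one₀ (pow_le_one₀ ht0 ht1) (abs_nonneg _) (Real.abs_cos_le_one _)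

/-- `continuous_cosD` (auxiliary). [folklore] -/
theorem continuous_cosD (n : ℕ) : Continuous fun p : ℝ × ℝ => cosD n p.1 p.2 := by
  unfold cosD; fun_prop

/-! ## `sincI n x = ∫₀¹ tⁿ cos(tx + nπ/2) dt` and differentiation under the integral -/

/-- The `n`-th derivative of `sinc`, as a parameter integral. [folklore] -/
def sincI (n : ℕ) (x : ℝ) : ℝ := ∫ t in (0 : ℝ)..1, cosD n t x

/-- **`∫₀¹ cos(tx) dt = sinc x`.** [folklore] -/
theorem sincI_zero (x : ℝ) : sincI 0 x = Real.sinc x := by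
  simp only [sincI, cosD_zero]
  by_cases hx : x = 0
  · subst hx; simp [Real.sinc_zero]
  · rw [Real.sinc_of_ne_zero hx]
    have h := intervalIntegral.integral_comp_mul_left (fun u => Real.cos u) (a := 0) (b := 1) hx
    simp only [mul_zero, mul_one] at h
    rw [show (fun t : ℝ => Real.cos (t * x)) = fun t => Real.cos (x * t) from funext fun t => by rw [mul_comm], h,
      integral_cos, Real.sin_zero, sub_zero, smul_eq_mul]
    field_simp

/-- `abs_sincI_le` (auxiliary): `|sincI n x| ≤ 1`. [folklore] -/
theorem abs_sincI_le (n : ℕ) (x : ℝ) : |sincI n x| ≤ 1 := by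
  rw [sincI]
  have h := intervalIntegral.norm_integral_le_of_norm_le_const (a := (0 : ℝ)) (b := 1) (C := 1)
    (f := fun t => cosD n t x) (fun t ht => ?_)
  · simpa using h
  · rw [Set.uIoc_of_le zero_le_one] at ht
    rw [Real.norm_eq_abs]
    exact abs_cosD_le n ht.1.le ht.2 x

/-- **Differentiation under the integral sign**: `(sincI n)' = sincI (n+1)`. [folklore] -/
theorem hasDerivAt_sincI (n : ℕ) (x₀ : ℝ) : HasDerivAt (sincI n) (sincI (n + 1) x₀) x₀ := by
  have hmeas : ∀ m : ℕ, ∀ x : ℝ, AEStronglyMeasurable (fun t => cosD m t x) (volume.restrict (Set.uIoc 0 1)) := fun m x =>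
    ((continuous_cosD m).comp (continuous_id.prodMk continuous_const)).aestronglyMeasurable
  have hint : ∀ m : ℕ, ∀ x : ℝ, IntervalIntegrable (fun t => cosD m t x) volume 0 1 := fun m x =>
    ((continuous_cosD m).comp (continuous_id.prodMk continuous_const)).intervalIntegrable 0 1
  have key := intervalIntegral.hasDerivAt_integral_of_dominated_loc_of_deriv_le (μ := volume) (a := (0 : ℝ)) (b := 1)
    (F := fun x t => cosD n t x) (F' := fun x t => cosD (n + 1) t x) (x₀ := x₀) (s := univ) (bound := fun _ => 1)
    univ_mem (Eventually.of_forall fun x => hmeas n x) (hint n x₀) (hmeas (n + 1) x₀) ?_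
    intervalIntegrable_const ?_
  · exact key.2
  · refine Eventually.of_forall fun t ht x _ => ?_
    rw [Set.uIoc_of_le zero_le_one] at ht
    rw [Real.norm_eq_abs]
    exact abs_cosD_le (n + 1) ht.1.le ht.2 x
  · exact Eventually.of_forall fun t _ x _ => hasDerivAt_cosD n t x

/-- `deriv_sincI` (auxiliary). [folklore] -/
theorem deriv_sincI (n : ℕ) : deriv (sincI n) = sincI (n + 1) := funext fun x => (hasDerivAt_sincI n x).deriv

/-- **`sinc⁽ⁿ⁾ = ∫₀¹ tⁿ cos(tx + nπ/2) dt`.** [folklore] -/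
theorem iteratedDeriv_sinc (n : ℕ) : iteratedDeriv n Real.sinc = sincI n := by
  induction n with
  | zero => funext x; rw [iteratedDeriv_zero, sincI_zero]
  | succ n ih => rw [iteratedDeriv_succ, ih, deriv_sincI]

/-- `differentiable_sincI` (auxiliary). [folklore] -/
theorem differentiable_sincI (n : ℕ) : Differentiable ℝ (sincI n) := fun x => (hasDerivAt_sincI n x).differentiableAt

/-- **`sinc` is smooth.** [folklore] -/
theorem contDiff_sinc : ContDiff ℝ ∞ Real.sinc :=
  contDiff_of_differentiable_iteratedDeriv fun m _ => by rw [iteratedDeriv_sinc]; exact differentiable_sincI m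

/-- **`|sinc⁽ⁿ⁾(x)| ≤ 1`.** [folklore] -/
theorem abs_iteratedDeriv_sinc_le (n : ℕ) (x : ℝ) : |iteratedDeriv n Real.sinc x| ≤ 1 := by
  rw [iteratedDeriv_sinc]; exact abs_sincI_le n x

/-- **`sinc` has temperate growth** (all derivatives bounded by `1`). [folklore] -/
theorem hasTemperateGrowth_sinc : Function.HasTemperateGrowth Real.sinc := by
  refine ⟨contDiff_sinc, fun n => ⟨0, 1, fun x => ?_⟩⟩
  rw [norm_iteratedFDeriv_eq_norm_iteratedDeriv, Real.norm_eq_abs, pow_zero, mul_one]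
  exact abs_iteratedDeriv_sinc_le n x

end Literature.Analysis.Fourier
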